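import Mathlib
import HarnessLib
import Summits.HubbardSuperconductivity.HubbardSuperconductivity.Theorems.KLProgrammeKLRegimeSectorMultiplierWtRates

/-!
# Route `KLProgramme` — engine support, route (L2): packaging of the isotropic ORDER-THREE pointwise constant of the thin PAIR
# `F_{ω₁}F_{ω₂}` as `κ₃ᴾ·W³/Λ³`

Cell `gate-hubbard-kl`, seat p3 (g10); program «W2 = weighted overlap rows», rates supplement of `…SectorMultiplierWtRates` (whose
`iso3_pack_le` packages the SINGLE-multiplier shape).  In the shape produced by `norm_fwdDiff_three_space_klAnisoPair_le`
(`…SectorMultiplierPairDiffsThird`: `τ = G₁·Wn`, `K₃ = 4 + 8A₃`, angular sizes `6B(X₁+X₂)`, `6B(X₁²+X₂²) + 72B²X₁X₂`,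
`6B(X₁³+X₂³) + 108B²(X₁²X₂ + X₁X₂²)`, `Xᵢ = Dᵢ·Wm`): if `0 ≤ Wn ≤ W`, `0 ≤ Wm ≤ 2W`, `0 ≤ Dᵢ ≤ 3N`, `Λ ≤ e₀`, `ΛN ≤ e₀`, `A₃Λ² ≤ a₃` then the
constant is `≤ κ₃ᴾ·W³/Λ³`,
`κ₃ᴾ = (8g₃+12g₂)G₁³ + (12g₂+6g₁)G₁K₂e₀ + 2g₁(4e₀²+8a₃) + 216B((4g₂+2g₁)G₁²e₀ + 2g₁K₂e₀²) + (2592B+15552B²)g₁G₁e₀² + (2592B+46656B²)e₀³`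
(**`iso3_pack_pair_le`**).  Pure real algebra. [folklore]
-/

noncomputable section

namespace Summit.HubbardSuperconductivity.HubbardSuperconductivity.Theorems.TorusFourierL2

set_option linter.dupNamespace false -- summit = problem name (single-conjunct summit), D-0017

open scoped Real

set_option maxHeartbeats 800000 in -- long explicit real bookkeeping
/-- **The isotropic order-three constant of the thin pair packaged as `κ₃ᴾ·W³/Λ³`** (see the module docstring). [folklore] -/
theorem iso3_pack_pair_le {g₁ g₂ g₃ G₁ K₂ A₃ a₃ B Λ N e₀ W Wn Wm D₁ D₂ : ℝ} (hg₁ : 0 ≤ g₁) (hg₂ : 0 ≤ g₂) (hg₃ : 0 ≤ g₃) (hG₁ : 0 ≤ G₁)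
    (hK₂ : 0 ≤ K₂) (hA₃ : 0 ≤ A₃) (hB : 0 ≤ B) (hΛ : 0 < Λ) (hN : 0 ≤ N) (hW : 0 ≤ W) (hWn0 : 0 ≤ Wn) (hWn : Wn ≤ W) (hWm0 : 0 ≤ Wm)
    (hWm : Wm ≤ 2 * W) (hD₁0 : 0 ≤ D₁) (hD₁ : D₁ ≤ 3 * N) (hD₂0 : 0 ≤ D₂) (hD₂ : D₂ ≤ 3 * N) (hΛe : Λ ≤ e₀) (hΛN : Λ * N ≤ e₀)
    (ha₃ : A₃ * Λ ^ 2 ≤ a₃) :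
    ((8 * g₃ + 12 * g₂) * (G₁ * Wn) ^ 3 / Λ ^ 3 + (12 * g₂ + 6 * g₁) * ((G₁ * Wn) * (K₂ * Wn ^ 2)) / Λ ^ 2 +
          2 * g₁ * ((4 + 8 * A₃) * Wn ^ 3) / Λ) * 1 +
        3 * (((4 * g₂ + 2 * g₁) * (G₁ * Wn) ^ 2 / Λ ^ 2 + 2 * g₁ * (K₂ * Wn ^ 2) / Λ) * (6 * B * (D₁ * Wm + D₂ * Wm))) +
        3 * (2 * g₁ * (G₁ * Wn) / Λ * (6 * B * ((D₁ * Wm) ^ 2 + (D₂ * Wm) ^ 2) + 72 * B ^ 2 * ((D₁ * Wm) * (D₂ * Wm)))) +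
        1 * (6 * B * ((D₁ * Wm) ^ 3 + (D₂ * Wm) ^ 3) + 108 * B ^ 2 * ((D₁ * Wm) ^ 2 * (D₂ * Wm) + (D₁ * Wm) * (D₂ * Wm) ^ 2)) ≤
      ((8 * g₃ + 12 * g₂) * G₁ ^ 3 + (12 * g₂ + 6 * g₁) * G₁ * K₂ * e₀ + 2 * g₁ * (4 * e₀ ^ 2 + 8 * a₃) +
          216 * B * ((4 * g₂ + 2 * g₁) * G₁ ^ 2 * e₀ + 2 * g₁ * K₂ * e₀ ^ 2) + (2592 * B + 15552 * B ^ 2) * g₁ * G₁ * e₀ ^ 2 +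
          (2592 * B + 46656 * B ^ 2) * e₀ ^ 3) * W ^ 3 / Λ ^ 3 := by
  have he : 0 ≤ e₀ := hΛ.le.trans hΛe
  have hW3 : Wn ^ 3 ≤ W ^ 3 := pow_le_pow_left₀ hWn0 hWn 3
  have hW2 : Wn ^ 2 ≤ W ^ 2 := pow_le_pow_left₀ hWn0 hWn 2
  have hX₁ : D₁ * Wm ≤ 3 * N * (2 * W) := mul_le_mul hD₁ hWm hWm0 (by positivity)
  have hX₂ : D₂ * Wm ≤ 3 * N * (2 * W) := mul_le_mul hD₂ hWm hWm0 (by positivity)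
  have hX₁0 : 0 ≤ D₁ * Wm := mul_nonneg hD₁0 hWm0
  have hX₂0 : 0 ≤ D₂ * Wm := mul_nonneg hD₂0 hWm0
  have hΛ3 : 0 < Λ ^ 3 := pow_pos hΛ 3
  set X : ℝ := 3 * N * (2 * W) with hXdef
  have hX0 : 0 ≤ X := by positivity
  -- the angular sizes against `X = 6NW`
  have hB6 : 0 ≤ 6 * B := by positivity
  have hB72 : 0 ≤ 72 * B ^ 2 := by positivity
  have hB108 : 0 ≤ 108 * B ^ 2 := by positivity
  have hz₁ : 6 * B * (D₁ * Wm + D₂ * Wm) ≤ 12 * B * X :=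
    calc 6 * B * (D₁ * Wm + D₂ * Wm) ≤ 6 * B * (X + X) := mul_le_mul_of_nonneg_left (add_le_add hX₁ hX₂) hB6
      _ = 12 * B * X := by ring
  have hz₂ : 6 * B * ((D₁ * Wm) ^ 2 + (D₂ * Wm) ^ 2) + 72 * B ^ 2 * ((D₁ * Wm) * (D₂ * Wm)) ≤ (12 * B + 72 * B ^ 2) * X ^ 2 := by
    have h1 : (D₁ * Wm) ^ 2 ≤ X ^ 2 := pow_le_pow_left₀ hX₁0 hX₁ 2
    have h2 : (D₂ * Wm) ^ 2 ≤ X ^ 2 := pow_le_pow_left₀ hX₂0 hX₂ 2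
    have h3 : (D₁ * Wm) * (D₂ * Wm) ≤ X * X := mul_le_mul hX₁ hX₂ hX₂0 hX0
    calc _ ≤ 6 * B * (X ^ 2 + X ^ 2) + 72 * B ^ 2 * (X * X) :=
          add_le_add (mul_le_mul_of_nonneg_left (add_le_add h1 h2) hB6) (mul_le_mul_of_nonneg_left h3 hB72)
      _ = (12 * B + 72 * B ^ 2) * X ^ 2 := by ring
  have hz₃ : 6 * B * ((D₁ * Wm) ^ 3 + (D₂ * Wm) ^ 3) + 108 * B ^ 2 * ((D₁ * Wm) ^ 2 * (D₂ * Wm) + (D₁ * Wm) * (D₂ * Wm) ^ 2) ≤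
      (12 * B + 216 * B ^ 2) * X ^ 3 := by
    have h1 : (D₁ * Wm) ^ 3 ≤ X ^ 3 := pow_le_pow_left₀ hX₁0 hX₁ 3
    have h2 : (D₂ * Wm) ^ 3 ≤ X ^ 3 := pow_le_pow_left₀ hX₂0 hX₂ 3
    have h3 : (D₁ * Wm) ^ 2 * (D₂ * Wm) ≤ X ^ 2 * X := mul_le_mul (pow_le_pow_left₀ hX₁0 hX₁ 2) hX₂ hX₂0 (by positivity)
    have h4 : (D₁ * Wm) * (D₂ * Wm) ^ 2 ≤ X * X ^ 2 := mul_le_mul hX₁ (pow_le_pow_left₀ hX₂0 hX₂ 2) (by positivity) hX0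
    calc _ ≤ 6 * B * (X ^ 3 + X ^ 3) + 108 * B ^ 2 * (X ^ 2 * X + X * X ^ 2) :=
          add_le_add (mul_le_mul_of_nonneg_left (add_le_add h1 h2) hB6) (mul_le_mul_of_nonneg_left (add_le_add h3 h4) hB108)
      _ = (12 * B + 216 * B ^ 2) * X ^ 3 := by ring
  -- term 1
  have t1 : (8 * g₃ + 12 * g₂) * (G₁ * Wn) ^ 3 / Λ ^ 3 ≤ (8 * g₃ + 12 * g₂) * G₁ ^ 3 * (W ^ 3 / Λ ^ 3) := by
    rw [mul_pow, mul_div_assoc, mul_assoc, mul_div_assoc]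
    refine mul_le_mul_of_nonneg_left ?_ (by positivity)
    exact mul_le_mul_of_nonneg_left (div_le_div_of_nonneg_right hW3 hΛ3.le) (by positivity)
  -- term 2
  have t2 : (12 * g₂ + 6 * g₁) * ((G₁ * Wn) * (K₂ * Wn ^ 2)) / Λ ^ 2 ≤ (12 * g₂ + 6 * g₁) * G₁ * K₂ * e₀ * (W ^ 3 / Λ ^ 3) := by
    have e : (12 * g₂ + 6 * g₁) * ((G₁ * Wn) * (K₂ * Wn ^ 2)) / Λ ^ 2 = (12 * g₂ + 6 * g₁) * G₁ * K₂ * Λ * (Wn ^ 3 / Λ ^ 3) := by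
      field_simp
    rw [e]
    have h1 : (12 * g₂ + 6 * g₁) * G₁ * K₂ * Λ ≤ (12 * g₂ + 6 * g₁) * G₁ * K₂ * e₀ := mul_le_mul_of_nonneg_left hΛe (by positivity)
    exact mul_le_mul h1 (div_le_div_of_nonneg_right hW3 hΛ3.le) (by positivity) (by positivity)
  -- term 3
  have t3 : 2 * g₁ * ((4 + 8 * A₃) * Wn ^ 3) / Λ ≤ 2 * g₁ * (4 * e₀ ^ 2 + 8 * a₃) * (W ^ 3 / Λ ^ 3) := by
    have e : 2 * g₁ * ((4 + 8 * A₃) * Wn ^ 3) / Λ = 2 * g₁ * (4 * Λ ^ 2 + 8 * (A₃ * Λ ^ 2)) * (Wn ^ 3 / Λ ^ 3) := by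
      field_simp
    rw [e]
    have hΛ2 : Λ ^ 2 ≤ e₀ ^ 2 := pow_le_pow_left₀ hΛ.le hΛe 2
    have h1 : 2 * g₁ * (4 * Λ ^ 2 + 8 * (A₃ * Λ ^ 2)) ≤ 2 * g₁ * (4 * e₀ ^ 2 + 8 * a₃) :=
      mul_le_mul_of_nonneg_left (by linarith) (by positivity)
    have h0 : 0 ≤ 2 * g₁ * (4 * e₀ ^ 2 + 8 * a₃) := le_trans (by positivity) h1
    exact mul_le_mul h1 (div_le_div_of_nonneg_right hW3 hΛ3.le) (by positivity) h0
  -- term 4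
  have t4 : 3 * (((4 * g₂ + 2 * g₁) * (G₁ * Wn) ^ 2 / Λ ^ 2 + 2 * g₁ * (K₂ * Wn ^ 2) / Λ) * (6 * B * (D₁ * Wm + D₂ * Wm))) ≤
      216 * B * ((4 * g₂ + 2 * g₁) * G₁ ^ 2 * e₀ + 2 * g₁ * K₂ * e₀ ^ 2) * (W ^ 3 / Λ ^ 3) := by
    have hbr : (4 * g₂ + 2 * g₁) * (G₁ * Wn) ^ 2 / Λ ^ 2 + 2 * g₁ * (K₂ * Wn ^ 2) / Λ ≤
        ((4 * g₂ + 2 * g₁) * G₁ ^ 2 * Λ + 2 * g₁ * K₂ * Λ ^ 2) * (W ^ 2 / Λ ^ 3) := by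
      have e : (4 * g₂ + 2 * g₁) * (G₁ * Wn) ^ 2 / Λ ^ 2 + 2 * g₁ * (K₂ * Wn ^ 2) / Λ =
          ((4 * g₂ + 2 * g₁) * G₁ ^ 2 * Λ + 2 * g₁ * K₂ * Λ ^ 2) * (Wn ^ 2 / Λ ^ 3) := by field_simp
      rw [e]
      exact mul_le_mul_of_nonneg_left (div_le_div_of_nonneg_right hW2 hΛ3.le) (by positivity)
    have hbr0 : 0 ≤ (4 * g₂ + 2 * g₁) * (G₁ * Wn) ^ 2 / Λ ^ 2 + 2 * g₁ * (K₂ * Wn ^ 2) / Λ := by positivity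
    calc 3 * (((4 * g₂ + 2 * g₁) * (G₁ * Wn) ^ 2 / Λ ^ 2 + 2 * g₁ * (K₂ * Wn ^ 2) / Λ) * (6 * B * (D₁ * Wm + D₂ * Wm)))
        ≤ 3 * ((((4 * g₂ + 2 * g₁) * G₁ ^ 2 * Λ + 2 * g₁ * K₂ * Λ ^ 2) * (W ^ 2 / Λ ^ 3)) * (12 * B * X)) :=
          mul_le_mul_of_nonneg_left (mul_le_mul hbr hz₁ (by positivity) (le_trans hbr0 hbr)) (by norm_num)
      _ = 216 * B * (((4 * g₂ + 2 * g₁) * G₁ ^ 2 * (Λ * N) + 2 * g₁ * K₂ * (Λ * (Λ * N)))) * (W ^ 3 / Λ ^ 3) := by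
          rw [hXdef]; ring
      _ ≤ 216 * B * ((4 * g₂ + 2 * g₁) * G₁ ^ 2 * e₀ + 2 * g₁ * K₂ * (e₀ * e₀)) * (W ^ 3 / Λ ^ 3) := by
          have hΛN0 : 0 ≤ Λ * N := by positivity
          gcongr
      _ = _ := by ring
  -- term 5
  have t5 : 3 * (2 * g₁ * (G₁ * Wn) / Λ * (6 * B * ((D₁ * Wm) ^ 2 + (D₂ * Wm) ^ 2) + 72 * B ^ 2 * ((D₁ * Wm) * (D₂ * Wm)))) ≤
      (2592 * B + 15552 * B ^ 2) * g₁ * G₁ * e₀ ^ 2 * (W ^ 3 / Λ ^ 3) := by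
    have h0 : 0 ≤ 2 * g₁ * (G₁ * Wn) / Λ := by positivity
    calc 3 * (2 * g₁ * (G₁ * Wn) / Λ * (6 * B * ((D₁ * Wm) ^ 2 + (D₂ * Wm) ^ 2) + 72 * B ^ 2 * ((D₁ * Wm) * (D₂ * Wm))))
        ≤ 3 * (2 * g₁ * (G₁ * W) / Λ * ((12 * B + 72 * B ^ 2) * X ^ 2)) := by
          refine mul_le_mul_of_nonneg_left (mul_le_mul ?_ hz₂ (by positivity) (by positivity)) (by norm_num)
          gcongr
      _ = (432 * B + 2592 * B ^ 2) * 6 * g₁ * G₁ * (Λ * N) ^ 2 * (W ^ 3 / Λ ^ 3) := by rw [hXdef]; field_simp; ring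
      _ ≤ (432 * B + 2592 * B ^ 2) * 6 * g₁ * G₁ * e₀ ^ 2 * (W ^ 3 / Λ ^ 3) := by
          have : (Λ * N) ^ 2 ≤ e₀ ^ 2 := pow_le_pow_left₀ (by positivity) hΛN 2
          gcongr
      _ = _ := by ring
  -- term 6
  have t6 : 1 * (6 * B * ((D₁ * Wm) ^ 3 + (D₂ * Wm) ^ 3) + 108 * B ^ 2 * ((D₁ * Wm) ^ 2 * (D₂ * Wm) + (D₁ * Wm) * (D₂ * Wm) ^ 2)) ≤
      (2592 * B + 46656 * B ^ 2) * e₀ ^ 3 * (W ^ 3 / Λ ^ 3) := by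
    calc _ ≤ 1 * ((12 * B + 216 * B ^ 2) * X ^ 3) := by rw [one_mul, one_mul]; exact hz₃
      _ = (12 * B + 216 * B ^ 2) * 216 * (Λ * N) ^ 3 * (W ^ 3 / Λ ^ 3) := by rw [hXdef]; field_simp; ring
      _ ≤ (12 * B + 216 * B ^ 2) * 216 * e₀ ^ 3 * (W ^ 3 / Λ ^ 3) := by
          have : (Λ * N) ^ 3 ≤ e₀ ^ 3 := pow_le_pow_left₀ (by positivity) hΛN 3
          gcongr
      _ = _ := by ring
  have etot : ((8 * g₃ + 12 * g₂) * G₁ ^ 3 + (12 * g₂ + 6 * g₁) * G₁ * K₂ * e₀ + 2 * g₁ * (4 * e₀ ^ 2 + 8 * a₃) +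
          216 * B * ((4 * g₂ + 2 * g₁) * G₁ ^ 2 * e₀ + 2 * g₁ * K₂ * e₀ ^ 2) + (2592 * B + 15552 * B ^ 2) * g₁ * G₁ * e₀ ^ 2 +
          (2592 * B + 46656 * B ^ 2) * e₀ ^ 3) * W ^ 3 / Λ ^ 3 =
      (8 * g₃ + 12 * g₂) * G₁ ^ 3 * (W ^ 3 / Λ ^ 3) + (12 * g₂ + 6 * g₁) * G₁ * K₂ * e₀ * (W ^ 3 / Λ ^ 3) +
        2 * g₁ * (4 * e₀ ^ 2 + 8 * a₃) * (W ^ 3 / Λ ^ 3) +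
        216 * B * ((4 * g₂ + 2 * g₁) * G₁ ^ 2 * e₀ + 2 * g₁ * K₂ * e₀ ^ 2) * (W ^ 3 / Λ ^ 3) +
        (2592 * B + 15552 * B ^ 2) * g₁ * G₁ * e₀ ^ 2 * (W ^ 3 / Λ ^ 3) + (2592 * B + 46656 * B ^ 2) * e₀ ^ 3 * (W ^ 3 / Λ ^ 3) := by
    ring
  rw [etot, mul_one]
  linarith [t1, t2, t3, t4, t5, t6]

end Summit.HubbardSuperconductivity.HubbardSuperconductivity.Theorems.TorusFourierL2

end
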